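import Summits.Parity.GeneralizedHardyLittlewood.Theorems.BeyondDiagonalBeatsQuarter.MellinBumpMoebius
import Summits.Parity.GeneralizedHardyLittlewood.Theorems.BeyondDiagonalBeatsQuarter.KernelFormXSqLocal
import HarnessLib

/-!
# Route `PrimeLevelFamEdge`, crux K_B (stmt-Parity-20343), line `diagonal_kernel_split` rev 4, plan Ω —
# **partial sums of the mollifier weight `W = μ/(id·ψ)` RESTRICTED TO `(n, d) = 1` decay like every power of
# `log`** (input I5a of the a8P-closable total: the divisor layers carry `c_{dm} ∝ 𝟙[(m,d)=1]·W(m)`)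

`MellinBumpMoebius.abs_sum_W_le` gives `A(N) = Σ_{n≤N} W(n) ≪_k (1 + log N)^{−k}`. For the divisor layers of the
off-diagonal core the weight is `𝟙[(n,d)=1]·W(n)` (`μ(dm) = μ(d)μ(m)𝟙[(m,d)=1]`), and C1 (`MellinBumpWeights`) needs
the same decay for `A_d(N) := Σ_{n≤N,(n,d)=1} W(n)`, with a constant controlled in `d`. One prime at a time:

* §1 `W_prime_mul` — `W(pm) = 𝟙[p∤m]·W(p)W(m)` (`W` multiplicative, supported on squarefree);
  `sum_Icc_filter_dvd_eq_sum_div` (reindex the multiples of `p`);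
* §2 `sum_coprime_mul_prime_eq` — the recursion `A_{pd}(N) = A_d(N) − W(p)·A_{pd}(⌊N/p⌋)` (`p ∤ d`), and its
  unrolled form `sum_coprime_mul_prime_eq_sum_pow`: `A_{pd}(N) = Σ_{i<T} (−W(p))^i·A_d(⌊N/p^i⌋)` (`N < p^T`);
* §3 `abs_sum_coprime_mul_prime_le` — one prime costs a factor `c_k = 2·4^k + 2K` INDEPENDENT of `p`
  (`|W(p)| ≤ 1/p`: the `i` with `p^{2i} ≤ N` see `A_d` at arguments `≥ √N/2`, the others carry `p^{−i} < N^{−1/2}`);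
* §4 **`abs_sum_coprime_W_le`** — for every `k`: `∃ C c > 0, ∀ d ≥ 1, ∀ N ≥ 1:
  |Σ_{n≤N,(n,d)=1} W(n)| ≤ C·c^{ω(d)}/(1 + log N)^k`, `ω(d) = #d.primeFactors` (induction on the prime factorisation).

The constant `c^{ω(d)} ≪_ε d^ε` is crude (the Dirichlet-series route gives `∏_{p∣d}(1 − √p/(p+1))^{−1} ≤ 2^{ω(d)}`) but
is summable against the layer weights `(d₁d₂)^{−3/2+o(1)}`. Theorems only; standard axioms. Helper toward
`stub_offDiagBelowSlack_io`; closes nothing.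
«The programme SEARCHES and TYPES; no claim about Landau–Siegel zeros, Theorems 1–2 of arXiv:2211.02515 or
a repaired Margin232 until a kernel theorem says so.»
-/

noncomputable section

open scoped Real ArithmeticFunction.Moebius
open Finset ArithmeticFunction

namespace Summit.Parity.GeneralizedHardyLittlewood.Theorems.BeyondDiagonalBeatsQuarter.MellinBump

open Literature.NumberTheory.LFunctions Literature.NumberTheory.LFunctions.KMV2000
open MollifierMainTerm (W)
open KernelFormXSq

/-! ### §1. `W` on prime multiples; reindexing multiples -/

/-- `W(p·m) = 0` if `p ∣ m` (not squarefree) and `= W(p)·W(m)` if `p ∤ m` (multiplicativity), for `p` prime,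
`m ≠ 0`. [folklore] -/
theorem W_prime_mul {p m : ℕ} (hp : p.Prime) (hm : m ≠ 0) :
    W (p * m) = if p ∣ m then 0 else W p * W m := by
  split_ifs with hpm
  · have hsq : ¬ Squarefree (p * m) := by
      intro h
      obtain ⟨c, rfl⟩ := hpm
      have h1 : p * p ∣ p * (p * c) := ⟨c, by ring⟩
      exact hp.not_isUnit (h p h1)
    rw [W_apply'' (mul_ne_zero hp.ne_zero hm), ArithmeticFunction.moebius_eq_zero_of_not_squarefree hsq]
    simp
  · exact isMultiplicative_W'.map_mul_of_coprime ((Nat.Prime.coprime_iff_not_dvd hp).2 hpm)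

/-- Reindexing the multiples of `p ≥ 1` in `[1, N]`: `Σ_{n≤N, p∣n} f(n) = Σ_{m≤N/p} f(pm)`. [folklore] -/
theorem sum_Icc_filter_dvd_eq_sum_div {p : ℕ} (hp : 0 < p) (N : ℕ) (f : ℕ → ℝ) :
    ∑ n ∈ (Icc 1 N).filter (fun n : ℕ ↦ p ∣ n), f n = ∑ m ∈ Icc 1 (N / p), f (p * m) := by
  have himg : (Icc 1 N).filter (fun n : ℕ ↦ p ∣ n) = (Icc 1 (N / p)).image (fun m ↦ p * m) := by
    ext n
    simp only [Finset.mem_filter, Finset.mem_Icc, Finset.mem_image]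
    constructor
    · rintro ⟨⟨h1, h2⟩, ⟨c, rfl⟩⟩
      refine ⟨c, ⟨?_, ?_⟩, rfl⟩
      · rcases Nat.eq_zero_or_pos c with rfl | hc
        · simp at h1
        · exact hc
      · exact (Nat.le_div_iff_mul_le hp).2 (by rw [mul_comm]; exact h2)
    · rintro ⟨c, ⟨h1, h2⟩, rfl⟩
      refine ⟨⟨Nat.mul_pos hp h1, ?_⟩, ⟨c, rfl⟩⟩
      have := (Nat.le_div_iff_mul_le hp).1 h2
      rw [mul_comm] at this
      exact this
  rw [himg, Finset.sum_image (fun a _ b _ h ↦ Nat.eq_of_mul_eq_mul_left hp h)]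

/-! ### §2. The recursion in one prime and its unrolled form -/

/-- **Recursion.** For `p` prime with `p ∤ d`:
`Σ_{n≤N,(n,pd)=1} W(n) = Σ_{n≤N,(n,d)=1} W(n) − W(p)·Σ_{m≤N/p,(m,pd)=1} W(m)`
(split the `d`-sum by `p ∣ n`; on the multiples `n = pm`, `W(pm) = 𝟙[p∤m]W(p)W(m)`). [folklore] -/
theorem sum_coprime_mul_prime_eq {p d : ℕ} (hp : p.Prime) (hpd : ¬ p ∣ d) (N : ℕ) :
    ∑ n ∈ Icc 1 N, (if n.Coprime (p * d) then W n else 0) =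
      ∑ n ∈ Icc 1 N, (if n.Coprime d then W n else 0) -
        W p * ∑ m ∈ Icc 1 (N / p), (if m.Coprime (p * d) then W m else 0) := by
  have hcopP : ∀ n : ℕ, n.Coprime (p * d) ↔ ¬ p ∣ n ∧ n.Coprime d := by
    intro n
    rw [Nat.coprime_mul_iff_right, Nat.coprime_comm, Nat.Prime.coprime_iff_not_dvd hp]
  have hsplit := (Finset.sum_filter_add_sum_filter_not (Icc 1 N) (fun n : ℕ ↦ p ∣ n)
    (fun n : ℕ ↦ if n.Coprime d then W n else 0)).symm
  have hnot : ∑ n ∈ (Icc 1 N).filter (fun n : ℕ ↦ ¬ p ∣ n), (if n.Coprime d then W n else 0) =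
      ∑ n ∈ Icc 1 N, (if n.Coprime (p * d) then W n else 0) := by
    rw [Finset.sum_filter]
    refine Finset.sum_congr rfl fun n _ ↦ ?_
    by_cases h1 : p ∣ n
    · rw [if_neg (not_not.2 h1), if_neg (fun h ↦ ((hcopP n).1 h).1 h1)]
    · rw [if_pos h1]
      by_cases h2 : n.Coprime d
      · rw [if_pos h2, if_pos ((hcopP n).2 ⟨h1, h2⟩)]
      · rw [if_neg h2, if_neg (fun h ↦ h2 ((hcopP n).1 h).2)]
  have hdvd : ∑ n ∈ (Icc 1 N).filter (fun n : ℕ ↦ p ∣ n), (if n.Coprime d then W n else 0) =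
      W p * ∑ m ∈ Icc 1 (N / p), (if m.Coprime (p * d) then W m else 0) := by
    rw [sum_Icc_filter_dvd_eq_sum_div hp.pos, Finset.mul_sum]
    refine Finset.sum_congr rfl fun m hm ↦ ?_
    have hm0 : m ≠ 0 := by have := (Finset.mem_Icc.1 hm).1; omega
    have hpd' : Nat.Coprime p d := (Nat.Prime.coprime_iff_not_dvd hp).2 hpd
    have hcop_pm : (p * m).Coprime d ↔ m.Coprime d := by
      rw [Nat.coprime_mul_iff_left]
      exact ⟨fun h ↦ h.2, fun h ↦ ⟨hpd', h⟩⟩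
    rw [W_prime_mul hp hm0]
    by_cases h1 : p ∣ m
    · rw [if_pos h1, if_neg (fun h ↦ ((hcopP m).1 h).1 h1)]
      simp
    · rw [if_neg h1]
      by_cases h2 : m.Coprime d
      · rw [if_pos (hcop_pm.2 h2), if_pos ((hcopP m).2 ⟨h1, h2⟩)]
      · rw [if_neg (fun h ↦ h2 (hcop_pm.1 h)), if_neg (fun h ↦ h2 ((hcopP m).1 h).2), mul_zero]
  rw [hsplit, hnot, hdvd]
  ring

/-- **Unrolled recursion.** For `p` prime with `p ∤ d` and `N < p^T`:
`Σ_{n≤N,(n,pd)=1} W(n) = Σ_{i<T} (−W(p))^i·Σ_{n≤N/p^i,(n,d)=1} W(n)`. [folklore] -/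
theorem sum_coprime_mul_prime_eq_sum_pow {p d : ℕ} (hp : p.Prime) (hpd : ¬ p ∣ d) (T : ℕ) :
    ∀ N : ℕ, N < p ^ T →
      ∑ n ∈ Icc 1 N, (if n.Coprime (p * d) then W n else 0) =
        ∑ i ∈ Finset.range T, (-W p) ^ i * ∑ n ∈ Icc 1 (N / p ^ i), (if n.Coprime d then W n else 0) := by
  induction T with
  | zero =>
    intro N hN
    have hN0 : N = 0 := by simpa using hN
    subst hN0
    simp
  | succ T ih =>
    intro N hN
    have hNp : N / p < p ^ T := (Nat.div_lt_iff_lt_mul hp.pos).2 (by rw [← pow_succ]; exact hN)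
    rw [sum_coprime_mul_prime_eq hp hpd N, ih (N / p) hNp, Finset.sum_range_succ']
    simp only [pow_zero, one_mul, Nat.div_one]
    rw [Finset.mul_sum, sub_eq_add_neg, ← Finset.sum_neg_distrib, add_comm]
    congr 1
    refine Finset.sum_congr rfl fun i _ ↦ ?_
    rw [Nat.div_div_eq_div_mul, ← pow_succ']
    ring

/-! ### §3. One prime costs a factor independent of `p` -/

/-- **One-prime step.** If `|Σ_{n≤N,(n,d)=1} W(n)| ≤ C/(1 + log N)^k` for all `N ≥ 1`, then for a prime `p ∤ d`
and all `N ≥ 1`: `|Σ_{n≤N,(n,pd)=1} W(n)| ≤ C·(2·4^k + 2K)/(1 + log N)^k`, where `K` is any constant with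
`y^{−1/2} ≤ K/(1 + log y)^{k+1}` (`y ≥ 1`; `MellinBump.rpow_neg_le_div_log_pow`). In the unrolled recursion the
`i` with `p^{2i} ≤ N` see arguments `N/p^i ≥ √N/2` (decay, `|W(p)|^i ≤ 2^{−i}`), the others carry
`|W(p)|^i ≤ p^{−i} < N^{−1/2}` and are at most `T ≤ (3/2)(1 + log N)` in number. [folklore] -/
theorem abs_sum_coprime_mul_prime_le {p d : ℕ} (hp : p.Prime) (hpd : ¬ p ∣ d) {k : ℕ} {C K : ℝ}
    (hC : 0 ≤ C) (hK0 : 0 ≤ K)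
    (hK : ∀ y : ℝ, 1 ≤ y → y ^ (-(1 / 2 : ℝ)) ≤ K / (1 + Real.log y) ^ (k + 1))
    (hd : ∀ N : ℕ, 1 ≤ N → |∑ n ∈ Icc 1 N, (if n.Coprime d then W n else 0)| ≤ C / (1 + Real.log N) ^ k)
    (N : ℕ) (hN : 1 ≤ N) :
    |∑ n ∈ Icc 1 N, (if n.Coprime (p * d) then W n else 0)| ≤
      C * (2 * 4 ^ k + 2 * K) / (1 + Real.log N) ^ k := by
  set T := Nat.log p N + 1 with hT
  have hNT : N < p ^ T := Nat.lt_pow_succ_log_self hp.one_lt N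
  rw [sum_coprime_mul_prime_eq_sum_pow hp hpd T N hNT]
  set S : ℕ → ℝ := fun e ↦ ∑ n ∈ Icc 1 e, (if n.Coprime d then W n else 0) with hS
  have hN0 : (0 : ℝ) < N := by exact_mod_cast hN
  have hN1 : (1 : ℝ) ≤ N := by exact_mod_cast hN
  have hlogN : 0 ≤ Real.log N := Real.log_nonneg hN1
  set L : ℝ := 1 + Real.log N with hL
  have hL1 : 1 ≤ L := by rw [hL]; linarith
  have hp2 : (2 : ℝ) ≤ p := by exact_mod_cast hp.two_le
  have hp0 : (0 : ℝ) < p := by linarith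
  have hWp : |W p| ≤ ((p : ℝ))⁻¹ := abs_W_le p
  have hWhalf : |W p| ≤ 1 / 2 := by
    refine hWp.trans ?_
    rw [one_div]
    exact inv_anti₀ (by norm_num) hp2
  -- `|S e| ≤ C` for every `e`
  have hSC : ∀ e : ℕ, |S e| ≤ C := by
    intro e
    rcases Nat.eq_zero_or_pos e with rfl | he
    · simp only [hS, show Icc 1 0 = (∅ : Finset ℕ) by rfl, Finset.sum_empty, abs_zero]
      exact hC
    · refine (hd e he).trans (div_le_self hC (one_le_pow₀ ?_))
      have : 0 ≤ Real.log (e : ℝ) := Real.log_nonneg (by exact_mod_cast he)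
      linarith
  -- per term of the unrolled recursion
  have hterm : ∀ i ∈ Finset.range T, |(-W p) ^ i * S (N / p ^ i)| ≤
      (1 / 2 : ℝ) ^ i * (4 ^ k * C / L ^ k) + C * (N : ℝ) ^ (-(1 / 2 : ℝ)) := by
    intro i _
    rw [abs_mul, abs_pow, abs_neg]
    have hq0 : 0 < p ^ i := pow_pos hp.pos i
    have hq0R : (0 : ℝ) < (p : ℝ) ^ i := by positivity
    have hnn1 : 0 ≤ (1 / 2 : ℝ) ^ i * (4 ^ k * C / L ^ k) := by positivity
    have hnn2 : 0 ≤ C * (N : ℝ) ^ (-(1 / 2 : ℝ)) := by positivity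
    rcases le_or_gt (((p : ℝ) ^ i) ^ 2) N with hsmall | hlarge
    · -- `p^{2i} ≤ N`: the argument `N/p^i` is at least `√N/2`
      have hed : 1 ≤ N / p ^ i := by
        refine (Nat.one_le_div_iff hq0).2 ?_
        have h1 : (1 : ℝ) ≤ (p : ℝ) ^ i := one_le_pow₀ (by linarith)
        have : (p : ℝ) ^ i ≤ N := by nlinarith
        exact_mod_cast this
      have hq : (N : ℝ) / (p : ℝ) ^ i / 2 ≤ ((N / p ^ i : ℕ) : ℝ) := by
        have h1 : (N : ℝ) / (p : ℝ) ^ i < ((N / p ^ i : ℕ) : ℝ) + 1 := by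
          have := Nat.lt_floor_add_one ((N : ℝ) / (p : ℝ) ^ i)
          rw [← Nat.cast_pow, Nat.floor_div_natCast, Nat.floor_natCast] at this
          push_cast at this
          exact this
        have h2 : (1 : ℝ) ≤ ((N / p ^ i : ℕ) : ℝ) := by exact_mod_cast hed
        linarith
      have hq1 : Real.sqrt N / 2 ≤ ((N / p ^ i : ℕ) : ℝ) := by
        refine le_trans ?_ hq
        have : Real.sqrt N ≤ (N : ℝ) / (p : ℝ) ^ i := by
          rw [le_div_iff₀ hq0R]
          have hsd : (p : ℝ) ^ i ≤ Real.sqrt N := Real.le_sqrt_of_sq_le hsmall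
          calc Real.sqrt N * (p : ℝ) ^ i ≤ Real.sqrt N * Real.sqrt N :=
                mul_le_mul_of_nonneg_left hsd (Real.sqrt_nonneg _)
            _ = N := Real.mul_self_sqrt hN0.le
        linarith
      have hlog : L / 4 ≤ 1 + Real.log ((N / p ^ i : ℕ) : ℝ) := by
        have hpos : 0 < Real.sqrt N / 2 := by positivity
        have h1 : Real.log (Real.sqrt N / 2) ≤ Real.log ((N / p ^ i : ℕ) : ℝ) :=
          Real.log_le_log hpos hq1
        have h2 : Real.log (Real.sqrt N / 2) = Real.log N / 2 - Real.log 2 := by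
          rw [Real.log_div (by positivity) (by norm_num), Real.log_sqrt hN0.le]
        have h3 : Real.log 2 < 0.7 := by
          have := Real.log_two_lt_d9; linarith
        rw [hL]; linarith
      have hb : |S (N / p ^ i)| ≤ 4 ^ k * C / L ^ k := by
        refine (hd (N / p ^ i) hed).trans ?_
        rw [div_le_div_iff₀ (by positivity) (by positivity)]
        calc C * L ^ k = C * (4 * (L / 4)) ^ k := by ring
          _ = 4 ^ k * C * (L / 4) ^ k := by rw [mul_pow]; ring
          _ ≤ 4 ^ k * C * (1 + Real.log ((N / p ^ i : ℕ) : ℝ)) ^ k := by gcongr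
      calc |W p| ^ i * |S (N / p ^ i)| ≤ (1 / 2 : ℝ) ^ i * (4 ^ k * C / L ^ k) :=
            mul_le_mul (pow_le_pow_left₀ (abs_nonneg _) hWhalf i) hb (abs_nonneg _) (by positivity)
        _ ≤ _ := le_add_of_nonneg_right hnn2
    · -- `p^{2i} > N`: `|W p|^i ≤ p^{−i} < N^{−1/2}`
      have h1 : |W p| ^ i ≤ ((p : ℝ) ^ i)⁻¹ := by
        rw [← inv_pow]
        exact pow_le_pow_left₀ (abs_nonneg _) hWp i
      have h2 : ((p : ℝ) ^ i)⁻¹ ≤ (N : ℝ) ^ (-(1 / 2 : ℝ)) := by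
        rw [Real.rpow_neg hN0.le, ← Real.sqrt_eq_rpow]
        refine inv_anti₀ (Real.sqrt_pos.2 hN0) ?_
        calc Real.sqrt N ≤ Real.sqrt (((p : ℝ) ^ i) ^ 2) := Real.sqrt_le_sqrt hlarge.le
          _ = (p : ℝ) ^ i := Real.sqrt_sq hq0R.le
      calc |W p| ^ i * |S (N / p ^ i)| ≤ (N : ℝ) ^ (-(1 / 2 : ℝ)) * C :=
            mul_le_mul (h1.trans h2) (hSC _) (abs_nonneg _) (by positivity)
        _ = C * (N : ℝ) ^ (-(1 / 2 : ℝ)) := mul_comm _ _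
        _ ≤ _ := le_add_of_nonneg_left hnn1
  -- the number of terms: `T ≤ (3/2)·L`
  have hTL : (T : ℝ) ≤ 3 / 2 * L := by
    have hN' : N ≠ 0 := by omega
    have hpow : ((p ^ Nat.log p N : ℕ) : ℝ) ≤ N := by exact_mod_cast Nat.pow_log_le_self p hN'
    have hlogp : Real.log 2 ≤ Real.log p := Real.log_le_log (by norm_num) hp2
    have h2 : (0.69 : ℝ) < Real.log 2 := by have := Real.log_two_gt_d9; linarith
    have h1 : (Nat.log p N : ℝ) * Real.log p ≤ Real.log N := by
      have := Real.log_le_log (by exact_mod_cast pow_pos hp.pos _) hpow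
      rw [Nat.cast_pow, Real.log_pow] at this
      exact this
    have h3 : (Nat.log p N : ℝ) * Real.log 2 ≤ Real.log N :=
      (mul_le_mul_of_nonneg_left hlogp (Nat.cast_nonneg _)).trans h1
    have h4 : (Nat.log p N : ℝ) ≤ 3 / 2 * Real.log N := by
      by_contra h
      push Not at h
      nlinarith [Nat.cast_nonneg (α := ℝ) (Nat.log p N)]
    rw [hT, hL]; push_cast; linarith
  calc |∑ i ∈ Finset.range T, (-W p) ^ i * S (N / p ^ i)|
      ≤ ∑ i ∈ Finset.range T, |(-W p) ^ i * S (N / p ^ i)| := Finset.abs_sum_le_sum_abs _ _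
    _ ≤ ∑ i ∈ Finset.range T, ((1 / 2 : ℝ) ^ i * (4 ^ k * C / L ^ k) + C * (N : ℝ) ^ (-(1 / 2 : ℝ))) :=
        Finset.sum_le_sum hterm
    _ = (∑ i ∈ Finset.range T, (1 / 2 : ℝ) ^ i) * (4 ^ k * C / L ^ k) +
          T * (C * (N : ℝ) ^ (-(1 / 2 : ℝ))) := by
        rw [Finset.sum_add_distrib, Finset.sum_mul, Finset.sum_const, Finset.card_range, nsmul_eq_mul]
    _ ≤ 2 * (4 ^ k * C / L ^ k) + (3 / 2 * L) * (C * (K / L ^ (k + 1))) := by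
        gcongr
        · exact sum_geometric_two_le T
        · exact hK N hN1
    _ = C * (2 * 4 ^ k + 3 / 2 * K) / L ^ k := by
        rw [pow_succ]
        field_simp
    _ ≤ C * (2 * 4 ^ k + 2 * K) / L ^ k := by
        gcongr
        norm_num

/-! ### §4. All primes: induction on the factorisation of `d` -/

/-- **Restricted partial sums of `W` decay like every power of `log`.** For every `k` there are `C > 0`, `c ≥ 1`
with `|Σ_{n≤N,(n,d)=1} W(n)| ≤ C·c^{ω(d)}/(1 + log N)^k` for all `d ≥ 1`, `N ≥ 1` (`ω(d) = #d.primeFactors`; `d = 1`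
is `MellinBumpMoebius.abs_sum_W_le`, each further prime costs the factor `c = 2·4^k + 2K` of §3).
[cite: MontgomeryVaughan2007, §8.1 (8.6) — derivation] -/
theorem abs_sum_coprime_W_le (k : ℕ) :
    ∃ C c : ℝ, 0 < C ∧ 1 ≤ c ∧ ∀ d : ℕ, 1 ≤ d → ∀ N : ℕ, 1 ≤ N →
      |∑ n ∈ Icc 1 N, (if n.Coprime d then W n else 0)| ≤
        C * c ^ d.primeFactors.card / (1 + Real.log N) ^ k := by
  obtain ⟨C, hC, hA⟩ := abs_sum_W_le k
  obtain ⟨K, hK, hKb⟩ := rpow_neg_le_div_log_pow (by norm_num : (0 : ℝ) < 1 / 2) (k + 1)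
  refine ⟨C, 2 * 4 ^ k + 2 * K, hC, ?_, ?_⟩
  · have : (1 : ℝ) ≤ 4 ^ k := one_le_pow₀ (by norm_num)
    linarith
  intro d
  induction d using Nat.strong_induction_on with
  | _ d ih =>
    intro hd N hN
    by_cases hd1 : d = 1
    · subst hd1
      have h1 : ∑ n ∈ Icc 1 N, (if n.Coprime 1 then W n else 0) = ∑ n ∈ Icc 1 N, W n :=
        Finset.sum_congr rfl fun n _ ↦ if_pos (Nat.coprime_one_right n)
      rw [h1, Nat.primeFactors_one, Finset.card_empty, pow_zero, mul_one]
      exact hA N hN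
    · obtain ⟨p, hp, hpd⟩ := Nat.exists_prime_and_dvd hd1
      obtain ⟨e, d', hpd', hdeq⟩ := Nat.exists_eq_pow_mul_and_not_dvd (by omega : d ≠ 0) p hp.ne_one
      have hd'0 : d' ≠ 0 := by rintro rfl; simp at hdeq; omega
      have he0 : e ≠ 0 := by
        rintro rfl
        rw [pow_zero, one_mul] at hdeq
        exact hpd' (hdeq ▸ hpd)
      have hd'lt : d' < d := by
        rw [hdeq]
        have : 2 ≤ p ^ e := le_trans hp.two_le (Nat.le_self_pow he0 p)
        calc d' = 1 * d' := (one_mul _).symm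
          _ < p ^ e * d' := Nat.mul_lt_mul_of_pos_right (by omega) (by omega)
      have hIH := ih d' hd'lt (by omega)
      -- coprimality to `d` is coprimality to `p·d'`
      have hcop : ∀ n : ℕ, n.Coprime d ↔ n.Coprime (p * d') := by
        intro n
        rw [hdeq, Nat.coprime_mul_iff_right, Nat.coprime_mul_iff_right,
          Nat.coprime_pow_right_iff (Nat.pos_of_ne_zero he0)]
      have hsum : ∑ n ∈ Icc 1 N, (if n.Coprime d then W n else 0) =
          ∑ n ∈ Icc 1 N, (if n.Coprime (p * d') then W n else 0) :=
        Finset.sum_congr rfl fun n _ ↦ by simp only [hcop n]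
      -- prime factors: `ω(d) = ω(d') + 1`
      have hcard : d.primeFactors.card = d'.primeFactors.card + 1 := by
        rw [hdeq, Nat.primeFactors_mul (pow_ne_zero e hp.ne_zero) hd'0, Nat.primeFactors_prime_pow he0 hp,
          ← Finset.insert_eq, Finset.card_insert_of_notMem]
        rw [Nat.mem_primeFactors_of_ne_zero hd'0]
        exact fun h ↦ hpd' h.2
      rw [hsum, hcard, pow_succ, ← mul_assoc]
      exact abs_sum_coprime_mul_prime_le hp hpd' (by positivity) hK.le hKb hIH N hN

end Summit.Parity.GeneralizedHardyLittlewood.Theorems.BeyondDiagonalBeatsQuarter.MellinBump
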